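import Summits.Ventures.HSemireg.WeilFrameTwoSlope
import Summits.Ventures.HSemireg.Mod4SlopeInfinitySpectrum

/-!
# Venture HSemireg — THEOREM R₂ ON THE REAL CARRIER for the slope pair `{λ, ∞}`: the classes `v = A e^{λh} + B·pt + w` on a
# Weil-type `2n`-fold, every `n` — side degrees `4C(2n,m) − 4C(n,m)`, middle degree `4C(2n,n) − 4` generically and `4C(2n,n) − 6`
# on the BOX LOCUS `t = AB`, Mukai density `((2AB + 2(−1)ⁿt)/(2n)!)·ĥ^{2n}` (proved directly, not through the pencil dual twist)

HONEST FRAMING. Part of the Lean index of the computation cell `pub-hsemireg` (seat w3-mod4-1 gen 9, W3 SPECIAL FIBRES;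
MOD4-OFFSPLIT (E21)/(E22) THEOREM R₂, TABLE R row «ρ(f) = 2: generic `P_n(t)² + 2tⁿ`, `P_n(t)²` exactly on the locus
`∫w² = (f,f)_χ`»). The tree's real carriers and the Literature's Weil-type layer ONLY: no semiregularity map, no Ext group, no `∫`;
nothing here says that HC / HC_CM / HC_AV holds; nothing here is a claim about any explicit variety; no Literature fact is declared;
NO definition is introduced (the two-slope sequence `q_m = Aλ^m + Bμ^m` is written out). THIS FILE DOES NOT NEED the unbuilt
`Mod4Carrier*` modules (imports: FILE 20 and the pure matrix file `Mod4TwoSlopeSpectrumGeneral`).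

WHAT IS PROVED, for `A : AbelianVariety ℂ` of dimension `2n` (`n ≥ 1`), `φ ≫ φ = -(d • 𝟙 A)`, `d ≥ 1`, `P, Q` the
`±i√d`-eigenspaces, `dim (P ⊓ H^{1,0}) = n`, `h` `K`-symmetric of type `(1,1)` with `ĥ^{2n} ≠ 0`, non-zero `c± ∈ E±`, the class
`x = Σ_{m ≤ 2n} (q_m/m!) ĥ^m + ĉ₊ + ĉ₋` with `q_m = Aλ^m + B·[m = 2n]`, `A, B ≠ 0` («slopes `{λ, ∞}`: `f = A e^{λh} + B·pt`, `pt = ĥ^{2n}/(2n)!`),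
and the pin `(2n)!·(ĉ₊ĉ₋) = t·ĥ^{2n}`:
* **`finrank_S_slopeInf_deg`** — `dim S_m(x) + 4C(n,m) = 4C(2n,m)` for `1 ≤ m ≤ n - 1` (`r_m = 2` by `Mod4.hankel1_rank_slopeInf`);
* **`finrank_S_slopeInf_middle_box`** — on the BOX LOCUS `t = AB`: `dim S_n(x) + 6 = 4C(2n,n)`;
* **`finrank_S_slopeInf_middle_generic`** — off it: `dim S_n(x) + 4 = 4C(2n,n)`;
* **`proj_mukaiDual_mul_top_slopeInf`** — the degree-`4n` part of `x^∨ · x` is `((2AB + 2(-1)ⁿ t)/(2n)!) · ĥ^{2n}`: the box locus is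
  again «`t = P_f(q)/2`».
(Same `n = 3` rows `(1,12,48,76∕74,48,12,1)` as for two finite slopes — the sheet's LEMMA S (c) orbit statement, now kernel in this
case without the symmetry.) Everything PROVED, 0 sorry.
References: [BuchweitzFlenner2008HH] Prop. 6.4.4; [vanGeemen1994HodgeAV] 4.9, Lemma 5.2; [BourbakiAlgebre1a3] Ch. III §8, §11 no. 9.
-/

noncomputable section

open CliffordAlgebra (contractLeft)
open ExteriorAlgebra (ι)
open Module CategoryTheory
open Literature.AlgebraicGeometry.Motives Literature.AlgebraicGeometry.HodgeTheory
open Literature.AlgebraicTopology.SingularHomology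

namespace Summit.Ventures.HSemireg.WeilFrame

open Summit.Ventures.HSemireg.WedgeBridge Summit.Ventures.HSemireg.WeilCarrier Summit.Ventures.HSemireg.Mod4Carrier
open Summit.Ventures.HSemireg.Wedge.Hankel

section RealCarrier

variable {A : AbelianVariety ℂ}

/-- **THEOREM R₂, lower side degrees on the real carrier** (`1 ≤ m ≤ n - 1`): for `q_m = Aλ^m + B·[m = 2n]`
(`A, B ≠ 0`): `dim S_m(x) + 4C(n,m) = 4C(2n,m)` (`r_m = 2`). [cite: BuchweitzFlenner2008HH, Prop. 6.4.4] -/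
theorem finrank_S_slopeInf_deg (hA : IsSmoothProjective A.dim A.X) {n d : ℕ} (hdim : A.dim = n + n) (hd : 0 < d)
    {φ : A ⟶ A} (hφ : φ ≫ φ = -(d • 𝟙 A)) {P Q : Submodule ℂ (complexBetti A.X 1)}
    (hP : P = Module.End.eigenspace (complexBetti.map φ.hom.hom.hom 1).hom (Complex.I * (Real.sqrt d : ℂ)))
    (hQ : Q = Module.End.eigenspace (complexBetti.map φ.hom.hom.hom 1).hom (-(Complex.I * (Real.sqrt d : ℂ))))
    (hp : finrank ℂ ↥(P ⊓ hodgeOneZero hA) = n) {h : complexBetti A.X 2}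
    (hh : complexBetti.map φ.hom.hom.hom 2 h = (d : ℂ) • h) (h11 : IsOfHodgeType A.dim A.X 2 1 1 h)
    (hvol : ((⋀[ℂ]^2 (complexBetti A.X 1)).subtype ((abelianVarietyCohomologyExteriorH1_holds.equiv A 2).symm h)) ^ (n + n) ≠ 0)
    {cP cQ : complexBetti A.X (2 * n)} (hcP : cP ∈ weilClassesPlus A φ n d) (hcP0 : cP ≠ 0)
    (hcQ : cQ ∈ weilClassesMinus A φ n d) (hcQ0 : cQ ≠ 0)
    {Aₛ Bₛ : ℂ} (la : ℂ) (hAs : Aₛ ≠ 0) (hBs : Bₛ ≠ 0) {m : ℕ} (hm1 : 1 ≤ m) (hmn : m + 1 ≤ n) :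
    finrank ℂ ↥(S ℂ (hodgeZeroOne hA) m
        ((∑ m ∈ Finset.range (n + n + 1), ((Aₛ * la ^ m + Bₛ * (if m = n + n then 1 else 0)) * ((m.factorial : ℕ) : ℂ)⁻¹) •
            ((⋀[ℂ]^2 (complexBetti A.X 1)).subtype ((abelianVarietyCohomologyExteriorH1_holds.equiv A 2).symm h)) ^ m) +
          (⋀[ℂ]^(2 * n) (complexBetti A.X 1)).subtype ((abelianVarietyCohomologyExteriorH1_holds.equiv A (2 * n)).symm cP) +
          (⋀[ℂ]^(2 * n) (complexBetti A.X 1)).subtype ((abelianVarietyCohomologyExteriorH1_holds.equiv A (2 * n)).symm cQ))) + 4 * n.choose m = 4 * (n + n).choose m := by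
  haveI : Module.Finite ℂ (complexBetti A.X 1) := abelianVarietyCohomologyExteriorH1_holds.finite_one A
  have h : finrank ℂ ↥(S ℂ (hodgeZeroOne hA) m
        ((∑ m ∈ Finset.range (n + n + 1), ((Aₛ * la ^ m + Bₛ * (if m = n + n then 1 else 0)) * ((m.factorial : ℕ) : ℂ)⁻¹) •
            ((⋀[ℂ]^2 (complexBetti A.X 1)).subtype ((abelianVarietyCohomologyExteriorH1_holds.equiv A 2).symm h)) ^ m) +
          (⋀[ℂ]^(2 * n) (complexBetti A.X 1)).subtype ((abelianVarietyCohomologyExteriorH1_holds.equiv A (2 * n)).symm cP) +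
          (⋀[ℂ]^(2 * n) (complexBetti A.X 1)).subtype ((abelianVarietyCohomologyExteriorH1_holds.equiv A (2 * n)).symm cQ))) +
        (n.choose m + n.choose m) * (hankel1 ℂ (n + n) m (fun m => Aₛ * la ^ m + Bₛ * (if m = n + n then 1 else 0))).rank =
      (n + n).choose m + (n + n).choose m + (n + n).choose m * (hankel1 ℂ (n + n) m (fun m => Aₛ * la ^ m + Bₛ * (if m = n + n then 1 else 0))).rank :=
    finrank_S_weilType_deg hA hdim hd hφ hP hQ hp hh h11 hvol hcP hcP0 hcQ hcQ0 (fun m => Aₛ * la ^ m + Bₛ * (if m = n + n then 1 else 0)) hm1 hmn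
  rw [Mod4.hankel1_rank_slopeInf hm1 (by omega) la hAs hBs] at h
  omega

/-- **THEOREM R₂, middle degree ON THE BOX LOCUS** `t = AB` (slopes `{λ, ∞}`): `dim S_n(x) + 6 = 4C(2n,n)` (`r_n = 2`, the
`t`-eigenspace of `M_f(q)` is a plane). [cite: BuchweitzFlenner2008HH, Prop. 6.4.4] -/
theorem finrank_S_slopeInf_middle_box (hA : IsSmoothProjective A.dim A.X) {n d : ℕ} (hdim : A.dim = n + n) (hd : 0 < d)
    {φ : A ⟶ A} (hφ : φ ≫ φ = -(d • 𝟙 A)) {P Q : Submodule ℂ (complexBetti A.X 1)}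
    (hP : P = Module.End.eigenspace (complexBetti.map φ.hom.hom.hom 1).hom (Complex.I * (Real.sqrt d : ℂ)))
    (hQ : Q = Module.End.eigenspace (complexBetti.map φ.hom.hom.hom 1).hom (-(Complex.I * (Real.sqrt d : ℂ))))
    (hp : finrank ℂ ↥(P ⊓ hodgeOneZero hA) = n) {h : complexBetti A.X 2}
    (hh : complexBetti.map φ.hom.hom.hom 2 h = (d : ℂ) • h) (h11 : IsOfHodgeType A.dim A.X 2 1 1 h)
    (hvol : ((⋀[ℂ]^2 (complexBetti A.X 1)).subtype ((abelianVarietyCohomologyExteriorH1_holds.equiv A 2).symm h)) ^ (n + n) ≠ 0)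
    {cP cQ : complexBetti A.X (2 * n)} (hcP : cP ∈ weilClassesPlus A φ n d) (hcP0 : cP ≠ 0)
    (hcQ : cQ ∈ weilClassesMinus A φ n d) (hcQ0 : cQ ≠ 0)
    {Aₛ Bₛ : ℂ} (la : ℂ) (hAs : Aₛ ≠ 0) (hBs : Bₛ ≠ 0) (hn : 1 ≤ n)
    (ht : (((n + n).factorial : ℕ) : ℂ) • ((⋀[ℂ]^(2 * n) (complexBetti A.X 1)).subtype ((abelianVarietyCohomologyExteriorH1_holds.equiv A (2 * n)).symm cP) *
        (⋀[ℂ]^(2 * n) (complexBetti A.X 1)).subtype ((abelianVarietyCohomologyExteriorH1_holds.equiv A (2 * n)).symm cQ)) =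
      (Aₛ * Bₛ) • ((⋀[ℂ]^2 (complexBetti A.X 1)).subtype ((abelianVarietyCohomologyExteriorH1_holds.equiv A 2).symm h)) ^ (n + n)) :
    finrank ℂ ↥(S ℂ (hodgeZeroOne hA) n
        ((∑ m ∈ Finset.range (n + n + 1), ((Aₛ * la ^ m + Bₛ * (if m = n + n then 1 else 0)) * ((m.factorial : ℕ) : ℂ)⁻¹) •
            ((⋀[ℂ]^2 (complexBetti A.X 1)).subtype ((abelianVarietyCohomologyExteriorH1_holds.equiv A 2).symm h)) ^ m) +
          (⋀[ℂ]^(2 * n) (complexBetti A.X 1)).subtype ((abelianVarietyCohomologyExteriorH1_holds.equiv A (2 * n)).symm cP) +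
          (⋀[ℂ]^(2 * n) (complexBetti A.X 1)).subtype ((abelianVarietyCohomologyExteriorH1_holds.equiv A (2 * n)).symm cQ))) + 6 = 4 * (n + n).choose n := by
  haveI : Module.Finite ℂ (complexBetti A.X 1) := abelianVarietyCohomologyExteriorH1_holds.finite_one A
  have h : finrank ℂ ↥(S ℂ (hodgeZeroOne hA) n
        ((∑ m ∈ Finset.range (n + n + 1), ((Aₛ * la ^ m + Bₛ * (if m = n + n then 1 else 0)) * ((m.factorial : ℕ) : ℂ)⁻¹) •
            ((⋀[ℂ]^2 (complexBetti A.X 1)).subtype ((abelianVarietyCohomologyExteriorH1_holds.equiv A 2).symm h)) ^ m) +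
          (⋀[ℂ]^(2 * n) (complexBetti A.X 1)).subtype ((abelianVarietyCohomologyExteriorH1_holds.equiv A (2 * n)).symm cP) +
          (⋀[ℂ]^(2 * n) (complexBetti A.X 1)).subtype ((abelianVarietyCohomologyExteriorH1_holds.equiv A (2 * n)).symm cQ))) +
        2 * (hankel1 ℂ (n + n) n (fun m => Aₛ * la ^ m + Bₛ * (if m = n + n then 1 else 0))).rank +
        finrank ℂ ↥(LinearMap.ker (Matrix.toLin' (Mod4.middleM n (fun m => Aₛ * la ^ m + Bₛ * (if m = n + n then 1 else 0))) - (Aₛ * Bₛ) • LinearMap.id)) =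
      ((hankel1 ℂ (n + n) n (fun m => Aₛ * la ^ m + Bₛ * (if m = n + n then 1 else 0))).rank + 2) * (n + n).choose n :=
    finrank_S_weilType_middle hA hdim hd hφ hP hQ hp hh h11 hvol hcP hcP0 hcQ hcQ0 hn (fun m => Aₛ * la ^ m + Bₛ * (if m = n + n then 1 else 0)) ht
  rw [Mod4.hankel1_rank_slopeInf hn (by omega) la hAs hBs, Mod4.finrank_ker_middleM_slopeInf_box hn la hAs hBs] at h
  omega

/-- **THEOREM R₂, middle degree OFF THE BOX LOCUS** (`t ≠ AB`, slopes `{λ, ∞}`; `t ≠ 0` is automatic): `dim S_n(x) + 4 = 4C(2n,n)`.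
[cite: BuchweitzFlenner2008HH, Prop. 6.4.4] -/
theorem finrank_S_slopeInf_middle_generic (hA : IsSmoothProjective A.dim A.X) {n d : ℕ} (hdim : A.dim = n + n) (hd : 0 < d)
    {φ : A ⟶ A} (hφ : φ ≫ φ = -(d • 𝟙 A)) {P Q : Submodule ℂ (complexBetti A.X 1)}
    (hP : P = Module.End.eigenspace (complexBetti.map φ.hom.hom.hom 1).hom (Complex.I * (Real.sqrt d : ℂ)))
    (hQ : Q = Module.End.eigenspace (complexBetti.map φ.hom.hom.hom 1).hom (-(Complex.I * (Real.sqrt d : ℂ))))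
    (hp : finrank ℂ ↥(P ⊓ hodgeOneZero hA) = n) {h : complexBetti A.X 2}
    (hh : complexBetti.map φ.hom.hom.hom 2 h = (d : ℂ) • h) (h11 : IsOfHodgeType A.dim A.X 2 1 1 h)
    (hvol : ((⋀[ℂ]^2 (complexBetti A.X 1)).subtype ((abelianVarietyCohomologyExteriorH1_holds.equiv A 2).symm h)) ^ (n + n) ≠ 0)
    {cP cQ : complexBetti A.X (2 * n)} (hcP : cP ∈ weilClassesPlus A φ n d) (hcP0 : cP ≠ 0)
    (hcQ : cQ ∈ weilClassesMinus A φ n d) (hcQ0 : cQ ≠ 0)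
    {Aₛ Bₛ : ℂ} (la : ℂ) (hAs : Aₛ ≠ 0) (hBs : Bₛ ≠ 0) (hn : 1 ≤ n) {t : ℂ}
    (ht : (((n + n).factorial : ℕ) : ℂ) • ((⋀[ℂ]^(2 * n) (complexBetti A.X 1)).subtype ((abelianVarietyCohomologyExteriorH1_holds.equiv A (2 * n)).symm cP) *
        (⋀[ℂ]^(2 * n) (complexBetti A.X 1)).subtype ((abelianVarietyCohomologyExteriorH1_holds.equiv A (2 * n)).symm cQ)) =
      t • ((⋀[ℂ]^2 (complexBetti A.X 1)).subtype ((abelianVarietyCohomologyExteriorH1_holds.equiv A 2).symm h)) ^ (n + n))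
    (hgen : t ≠ Aₛ * Bₛ) :
    finrank ℂ ↥(S ℂ (hodgeZeroOne hA) n
        ((∑ m ∈ Finset.range (n + n + 1), ((Aₛ * la ^ m + Bₛ * (if m = n + n then 1 else 0)) * ((m.factorial : ℕ) : ℂ)⁻¹) •
            ((⋀[ℂ]^2 (complexBetti A.X 1)).subtype ((abelianVarietyCohomologyExteriorH1_holds.equiv A 2).symm h)) ^ m) +
          (⋀[ℂ]^(2 * n) (complexBetti A.X 1)).subtype ((abelianVarietyCohomologyExteriorH1_holds.equiv A (2 * n)).symm cP) +
          (⋀[ℂ]^(2 * n) (complexBetti A.X 1)).subtype ((abelianVarietyCohomologyExteriorH1_holds.equiv A (2 * n)).symm cQ))) + 4 = 4 * (n + n).choose n := by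
  haveI : Module.Finite ℂ (complexBetti A.X 1) := abelianVarietyCohomologyExteriorH1_holds.finite_one A
  have ht0 := pin_ne_zero_weilType hA hdim hd hφ hP hQ hp hh h11 hvol hcP hcP0 hcQ hcQ0 ht
  have h : finrank ℂ ↥(S ℂ (hodgeZeroOne hA) n
        ((∑ m ∈ Finset.range (n + n + 1), ((Aₛ * la ^ m + Bₛ * (if m = n + n then 1 else 0)) * ((m.factorial : ℕ) : ℂ)⁻¹) •
            ((⋀[ℂ]^2 (complexBetti A.X 1)).subtype ((abelianVarietyCohomologyExteriorH1_holds.equiv A 2).symm h)) ^ m) +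
          (⋀[ℂ]^(2 * n) (complexBetti A.X 1)).subtype ((abelianVarietyCohomologyExteriorH1_holds.equiv A (2 * n)).symm cP) +
          (⋀[ℂ]^(2 * n) (complexBetti A.X 1)).subtype ((abelianVarietyCohomologyExteriorH1_holds.equiv A (2 * n)).symm cQ))) +
        2 * (hankel1 ℂ (n + n) n (fun m => Aₛ * la ^ m + Bₛ * (if m = n + n then 1 else 0))).rank +
        finrank ℂ ↥(LinearMap.ker (Matrix.toLin' (Mod4.middleM n (fun m => Aₛ * la ^ m + Bₛ * (if m = n + n then 1 else 0))) - t • LinearMap.id)) =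
      ((hankel1 ℂ (n + n) n (fun m => Aₛ * la ^ m + Bₛ * (if m = n + n then 1 else 0))).rank + 2) * (n + n).choose n :=
    finrank_S_weilType_middle hA hdim hd hφ hP hQ hp hh h11 hvol hcP hcP0 hcQ hcQ0 hn (fun m => Aₛ * la ^ m + Bₛ * (if m = n + n then 1 else 0)) ht
  rw [Mod4.hankel1_rank_slopeInf hn (by omega) la hAs hBs, Mod4.finrank_ker_middleM_slopeInf_generic hn Aₛ Bₛ la ht0 hgen] at h
  omega

/-- **Mukai density of a `{λ, ∞}` class on the real carrier:** the degree-`4n` part of `x^∨ · x` is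
`((2AB + 2(-1)ⁿ t)/(2n)!) · ĥ^{2n}` — so the box locus `t = AB` is exactly «`P_f(q) = 2t`», i.e. under the
reading `∫ĥ^{2n} = (2n)!·D` the sheet's «`∫w² = (f,f)_χ`». [cite: MumfordAV1970, §16] [cite: BuchweitzFlenner2008HH, Prop. 6.4.4] -/
theorem proj_mukaiDual_mul_top_slopeInf (hA : IsSmoothProjective A.dim A.X) {n d : ℕ} (hdim : A.dim = n + n) (hd : 0 < d)
    {φ : A ⟶ A} (hφ : φ ≫ φ = -(d • 𝟙 A)) {P Q : Submodule ℂ (complexBetti A.X 1)}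
    (hP : P = Module.End.eigenspace (complexBetti.map φ.hom.hom.hom 1).hom (Complex.I * (Real.sqrt d : ℂ)))
    (hQ : Q = Module.End.eigenspace (complexBetti.map φ.hom.hom.hom 1).hom (-(Complex.I * (Real.sqrt d : ℂ))))
    (hp : finrank ℂ ↥(P ⊓ hodgeOneZero hA) = n) {h : complexBetti A.X 2}
    (hh : complexBetti.map φ.hom.hom.hom 2 h = (d : ℂ) • h) (h11 : IsOfHodgeType A.dim A.X 2 1 1 h)
    (hvol : ((⋀[ℂ]^2 (complexBetti A.X 1)).subtype ((abelianVarietyCohomologyExteriorH1_holds.equiv A 2).symm h)) ^ (n + n) ≠ 0)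
    {cP cQ : complexBetti A.X (2 * n)} (hcP : cP ∈ weilClassesPlus A φ n d) (hcP0 : cP ≠ 0)
    (hcQ : cQ ∈ weilClassesMinus A φ n d) (hcQ0 : cQ ≠ 0)
    (Aₛ Bₛ la : ℂ) (hn : 1 ≤ n) {t : ℂ}
    (ht : (((n + n).factorial : ℕ) : ℂ) • ((⋀[ℂ]^(2 * n) (complexBetti A.X 1)).subtype ((abelianVarietyCohomologyExteriorH1_holds.equiv A (2 * n)).symm cP) *
        (⋀[ℂ]^(2 * n) (complexBetti A.X 1)).subtype ((abelianVarietyCohomologyExteriorH1_holds.equiv A (2 * n)).symm cQ)) =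
      t • ((⋀[ℂ]^2 (complexBetti A.X 1)).subtype ((abelianVarietyCohomologyExteriorH1_holds.equiv A 2).symm h)) ^ (n + n)) :
    GradedAlgebra.proj (fun i : ℕ => ⋀[ℂ]^i (complexBetti A.X 1)) ((n + n) + (n + n))
        (((∑ m ∈ Finset.range (n + n + 1), (((-1 : ℂ) ^ m * (Aₛ * la ^ m + Bₛ * (if m = n + n then 1 else 0))) * ((m.factorial : ℕ) : ℂ)⁻¹) •
              ((⋀[ℂ]^2 (complexBetti A.X 1)).subtype ((abelianVarietyCohomologyExteriorH1_holds.equiv A 2).symm h)) ^ m) +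
            (-1 : ℂ) ^ n •
              ((⋀[ℂ]^(2 * n) (complexBetti A.X 1)).subtype ((abelianVarietyCohomologyExteriorH1_holds.equiv A (2 * n)).symm cP) +
                (⋀[ℂ]^(2 * n) (complexBetti A.X 1)).subtype ((abelianVarietyCohomologyExteriorH1_holds.equiv A (2 * n)).symm cQ))) *
          ((∑ m ∈ Finset.range (n + n + 1), ((Aₛ * la ^ m + Bₛ * (if m = n + n then 1 else 0)) * ((m.factorial : ℕ) : ℂ)⁻¹) •
            ((⋀[ℂ]^2 (complexBetti A.X 1)).subtype ((abelianVarietyCohomologyExteriorH1_holds.equiv A 2).symm h)) ^ m) +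
            (⋀[ℂ]^(2 * n) (complexBetti A.X 1)).subtype ((abelianVarietyCohomologyExteriorH1_holds.equiv A (2 * n)).symm cP) +
            (⋀[ℂ]^(2 * n) (complexBetti A.X 1)).subtype ((abelianVarietyCohomologyExteriorH1_holds.equiv A (2 * n)).symm cQ))) =
      ((2 * (Aₛ * Bₛ) + 2 * ((-1 : ℂ) ^ n * t)) * ((((n + n).factorial : ℕ) : ℂ)⁻¹)) •
        ((⋀[ℂ]^2 (complexBetti A.X 1)).subtype ((abelianVarietyCohomologyExteriorH1_holds.equiv A 2).symm h)) ^ (n + n) := by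
  rw [proj_mukaiDual_mul_top_weilType hA hdim hd hφ hP hQ hp hh h11 hvol hcP hcP0 hcQ hcQ0 hn (fun m => Aₛ * la ^ m + Bₛ * (if m = n + n then 1 else 0)) ht,
    Mod4.mukaiP_slopeInf hn]

end RealCarrier

end Summit.Ventures.HSemireg.WeilFrame

end
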